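import Summits.ResolutionOfSingularities.ResolutionOfSingularities.Theorems.WildQuotientsWildQuotientResolutionToricChartWords
import Literature.RingTheory.TightClosure.FrobeniusSplitting
import HarnessLib

/-!
# T-TOR IN-HOUSE, F-SIDE: saturated monomial algebras are FROBENIUS SPLIT, so every ideal of every local ring is Frobenius closed
# (crux `FInjectiveMacaulayfication` stmt-ResolutionOfSingularities-15315, chain w45a; res-L1-w45a-plan-1 RULING R23.13 (2) + ADDENDUM
# «T-TOR in-house, scoped»; seat res-L1-w45a-lead-1 g13, CHECKPOINT shape (SAT′))

[OURS · L1 W4.5a] Support file (`--supports stmt-ResolutionOfSingularities-15315 --as helper`); def-free; UNCONDITIONAL; no named fact;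
NOT a statement of any manuscript; replaces the role of NO printed item (on paper: Hochster's «normal semigroup rings are F-pure»,
here proved for the w45c presented cone rings `ToricChart.Ring k P D` from a finite saturation hypothesis). AI-written (AI review is
weaker than expert review). Nothing of the crux is proved here.

THE CONSTRUCTION (tri-2 g21 SANITY-READ l.85829, with the coefficient step done by Mathlib in one line).
* §1 `exists_split_field` — EVERY field `k` of characteristic `p` is F-split: a `k`-linear `ψ : F_* k → k` with `ψ(1) = 1`
  (`F_* k` = `Literature.RingTheory.TightClosure.FrobeniusPushforward p 1 k`, the field `k` with `a • x = a^p x`; `1 ≠ 0` and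
  `Module.Projective.exists_dual_eq_one` — no perfectness, no `p`-basis).
* §2 `exists_split_mvPolynomial` — polynomial rings over an F-split ring are F-split, by the EXPLICIT map
  `Φ(c · x^m) = ψ(c) · x^{m/p}` if `p ∣ m` (coordinatewise) and `0` otherwise; `Φ(f^p g) = f Φ(g)`, `Φ(1) = 1`.
* §3 `exists_eq_theta_of_forall_word` (an element of `k[x, passengers]` all of whose monomials have word exponents on the
  distinguished variables is in the image of `θ : Ring k P D ↪ k[x, passengers]`) and ★ `exists_split_toricRing` — under the
  saturation hypothesis (SAT′) «`p ∣ wordExp D w` coordinatewise ⇒ `wordExp D w = p • wordExp D w′` for some word `w′`» the ambient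
  splitting `Φ` PRESERVES `θ(Ring k P D)`, so `Ring k P D` is F-split (every field `k` of characteristic `p`, any passenger type `P`).
* §4 `fClause_of_split` — in any localisation of an F-split ring every ideal satisfies the crux's inline Frobenius-closure clause
  `(∃ e, y^{p^e} ∈ (z^{p^e} : z ∈ I)) → y ∈ I` (tree ✓`isFrobeniusClosed_localization_of_split` + ✓`isFrobeniusClosed_iff`);
  ★ `fClause_localization_toricRing` — the same for every ideal of every localisation of a (SAT′) cone ring.
[cite: HochsterRoberts1976 (context: F-purity of normal semigroup rings); Fedder1983, §1 (F-purity is local); folklore]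
-/

-- single-problem summit: the doubled namespace component is forced
set_option linter.dupNamespace false

noncomputable section

open MvPolynomial

namespace Summit.ResolutionOfSingularities.ResolutionOfSingularities.Theorems.FInjectiveMacaulayfication.ToricRingSplitting

open Summit.ResolutionOfSingularities.ResolutionOfSingularities.Theorems.WildQuotientResolution
open Summit.ResolutionOfSingularities.ResolutionOfSingularities.Theorems.WildQuotientResolution.ToricChart
open Literature.RingTheory.TightClosure Literature.RingTheory.TightClosure.FrobeniusPushforward

/-! ## §1 Fields are F-split -/

/-- **Every field of characteristic `p` is F-split**: there is a `k`-linear `ψ : F_* k → k` (i.e. `ψ` additive with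
`ψ(a^p x) = a ψ(x)`) with `ψ(1) = 1`. [folklore; Mathlib `Module.Projective.exists_dual_eq_one`] -/
theorem exists_split_field (p : ℕ) [Fact p.Prime] (k : Type) [Field k] [CharP k p] :
    ∃ ψ : FrobeniusPushforward p 1 k →ₗ[k] k, ψ (toPush 1) = 1 := by
  have h1 : (toPush 1 : FrobeniusPushforward p 1 k) ≠ 0 := by
    rw [Ne, map_eq_zero_iff _ (toPush (p := p) (e := 1) (R := k)).injective]
    exact one_ne_zero
  exact Module.Projective.exists_dual_eq_one k h1

/-! ## §2 Polynomial rings over F-split rings are F-split -/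

/-- Divisibility of `p • a + m` by `p` coordinatewise is that of `m`. [plumbing] -/
theorem forall_dvd_smul_add_iff {σ : Type} (p : ℕ) (a m : σ →₀ ℕ) :
    (∀ i, p ∣ (p • a + m) i) ↔ ∀ i, p ∣ m i := by
  refine forall_congr' fun i => ?_
  rw [Finsupp.add_apply, Finsupp.smul_apply, smul_eq_mul]
  exact (Nat.dvd_add_right (dvd_mul_right p (a i)))

/-- `(p • a + m) / p = a + m / p` coordinatewise when `p ∣ m`. [plumbing] -/
theorem mapRange_div_smul_add {σ : Type} (p : ℕ) (hp : 0 < p) (a m : σ →₀ ℕ) (hm : ∀ i, p ∣ m i) :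
    (p • a + m).mapRange (· / p) (Nat.zero_div p) = a + m.mapRange (· / p) (Nat.zero_div p) := by
  ext i
  simp only [Finsupp.mapRange_apply, Finsupp.add_apply, Finsupp.smul_apply, smul_eq_mul]
  obtain ⟨c, hc⟩ := hm i
  rw [hc, ← mul_add, Nat.mul_div_cancel_left _ hp, Nat.mul_div_cancel_left _ hp]

/-- **Polynomial rings over an F-split ring are F-split, explicitly.** If `ψ : F_* A → A` is `A`-linear with `ψ(1) = 1`, then
`Φ(c x^m) := ψ(c) x^{m/p}` for `p ∣ m` (coordinatewise), `:= 0` otherwise, is an `A[x_σ]`-linear map `F_* A[x_σ] → A[x_σ]` with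
`Φ(1) = 1`. [folklore] -/
theorem exists_split_mvPolynomial (p : ℕ) [hp : Fact p.Prime] {A : Type} [CommRing A] [CharP A p] (σ : Type)
    (ψ : FrobeniusPushforward p 1 A →ₗ[A] A) (hψ : ψ (toPush 1) = 1) :
    ∃ Φ : FrobeniusPushforward p 1 (MvPolynomial σ A) →ₗ[MvPolynomial σ A] MvPolynomial σ A,
      Φ (toPush 1) = 1 ∧
      (∀ (m : σ →₀ ℕ) (c : A), (∀ i, p ∣ m i) →
        Φ (toPush (monomial m c)) = monomial (m.mapRange (· / p) (Nat.zero_div p)) (ψ (toPush c))) ∧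
      (∀ (m : σ →₀ ℕ) (c : A), ¬ (∀ i, p ∣ m i) → Φ (toPush (monomial m c)) = 0) := by
  classical
  have hp0 : 0 < p := hp.out.pos
  -- the coefficient map and the per-monomial maps
  let ψ₀ : A →+ A := ψ.toAddMonoidHom.comp (toPush (p := p) (e := 1) (R := A)).toAddMonoidHom
  have hψ₀ : ∀ c, ψ₀ c = ψ (toPush c) := fun c => rfl
  let g : (σ →₀ ℕ) → A →+ MvPolynomial σ A := fun m =>
    if (∀ i, p ∣ m i) then (monomial (m.mapRange (· / p) (Nat.zero_div p))).toAddMonoidHom.comp ψ₀ else 0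
  let Φ₀ : MvPolynomial σ A →+ MvPolynomial σ A :=
    (Finsupp.liftAddHom g).comp (AddMonoidAlgebra.coeffAddEquiv (R := A) (M := σ →₀ ℕ)).toAddMonoidHom
  have hΦ₀yes : ∀ (m : σ →₀ ℕ) (c : A), (∀ i, p ∣ m i) →
      Φ₀ (monomial m c) = monomial (m.mapRange (· / p) (Nat.zero_div p)) (ψ (toPush c)) := by
    intro m c hm
    show Finsupp.liftAddHom g (AddMonoidAlgebra.coeffAddEquiv (AddMonoidAlgebra.single m c)) = _
    rw [show AddMonoidAlgebra.coeffAddEquiv (AddMonoidAlgebra.single m c) = Finsupp.single m c from rfl,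
      Finsupp.liftAddHom_apply_single]
    simp only [g, if_pos hm]
    rfl
  have hΦ₀no : ∀ (m : σ →₀ ℕ) (c : A), ¬ (∀ i, p ∣ m i) → Φ₀ (monomial m c) = 0 := by
    intro m c hm
    show Finsupp.liftAddHom g (AddMonoidAlgebra.coeffAddEquiv (AddMonoidAlgebra.single m c)) = _
    rw [show AddMonoidAlgebra.coeffAddEquiv (AddMonoidAlgebra.single m c) = Finsupp.single m c from rfl,
      Finsupp.liftAddHom_apply_single]
    simp only [g, if_neg hm]
    rfl
  -- `ψ (c₁^p c₂) = c₁ ψ(c₂)`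
  have hψmul : ∀ c₁ c₂ : A, ψ (toPush (c₁ ^ p * c₂)) = c₁ * ψ (toPush c₂) := by
    intro c₁ c₂
    have h := ψ.map_smul c₁ (toPush c₂)
    rw [smul_toPush, pow_one, smul_eq_mul] at h
    exact h
  -- semilinearity on monomials
  have key : ∀ (a : σ →₀ ℕ) (c₁ : A) (m : σ →₀ ℕ) (c₂ : A),
      Φ₀ ((monomial a c₁) ^ p * monomial m c₂) = monomial a c₁ * Φ₀ (monomial m c₂) := by
    intro a c₁ m c₂
    rw [monomial_pow, monomial_mul]
    by_cases hm : ∀ i, p ∣ m i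
    · rw [hΦ₀yes _ _ ((forall_dvd_smul_add_iff p a m).mpr hm), hΦ₀yes _ _ hm, monomial_mul, hψmul,
        mapRange_div_smul_add p hp0 a m hm]
    · rw [hΦ₀no _ _ (fun h => hm ((forall_dvd_smul_add_iff p a m).mp h)), hΦ₀no _ _ hm, mul_zero]
  -- semilinearity for a monomial against every polynomial
  have key2 : ∀ (a : σ →₀ ℕ) (c₁ : A) (G : MvPolynomial σ A),
      Φ₀ ((monomial a c₁) ^ p * G) = monomial a c₁ * Φ₀ G := by
    intro a c₁ G
    induction G using MvPolynomial.induction_on' with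
    | monomial m c₂ => exact key a c₁ m c₂
    | add G₁ G₂ h₁ h₂ => rw [mul_add, map_add, h₁, h₂, map_add, mul_add]
  -- full semilinearity
  have key3 : ∀ F G : MvPolynomial σ A, Φ₀ (F ^ p * G) = F * Φ₀ G := by
    intro F G
    induction F using MvPolynomial.induction_on' with
    | monomial a c₁ => exact key2 a c₁ G
    | add F₁ F₂ h₁ h₂ => rw [add_pow_expChar, add_mul, map_add, h₁, h₂, add_mul]
  have hone : Φ₀ 1 = 1 := by
    rw [show (1 : MvPolynomial σ A) = monomial 0 1 from rfl, hΦ₀yes 0 1 (fun i => dvd_zero p), hψ, Finsupp.mapRange_zero]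
  -- package as an `A[x]`-linear map on the push-forward
  refine ⟨{ toFun := fun x => Φ₀ ((toPush (p := p) (e := 1) (R := MvPolynomial σ A)).symm x)
            map_add' := fun x y => by rw [map_add, map_add]
            map_smul' := fun F x => ?_ }, ?_, ?_, ?_⟩
  · obtain ⟨G, rfl⟩ := (toPush (p := p) (e := 1) (R := MvPolynomial σ A)).surjective x
    rw [smul_toPush, RingEquiv.symm_apply_apply, RingEquiv.symm_apply_apply, pow_one, RingHom.id_apply, smul_eq_mul]
    exact key3 F G
  · show Φ₀ ((toPush (p := p) (e := 1) (R := MvPolynomial σ A)).symm (toPush 1)) = 1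
    rw [RingEquiv.symm_apply_apply]
    exact hone
  · intro m c hm
    show Φ₀ ((toPush (p := p) (e := 1) (R := MvPolynomial σ A)).symm (toPush (monomial m c))) = _
    rw [RingEquiv.symm_apply_apply]
    exact hΦ₀yes m c hm
  · intro m c hm
    show Φ₀ ((toPush (p := p) (e := 1) (R := MvPolynomial σ A)).symm (toPush (monomial m c))) = 0
    rw [RingEquiv.symm_apply_apply]
    exact hΦ₀no m c hm

/-- Support of the split image: every monomial of `Φ(F)` is `m / p` for a monomial `m` of `F` divisible by `p`. [plumbing] -/
theorem support_split_subset (p : ℕ) [Fact p.Prime] {A : Type} [CommRing A] [CharP A p] {σ : Type}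
    (ψ : FrobeniusPushforward p 1 A →ₗ[A] A)
    (Φ : FrobeniusPushforward p 1 (MvPolynomial σ A) →ₗ[MvPolynomial σ A] MvPolynomial σ A)
    (hyes : ∀ (m : σ →₀ ℕ) (c : A), (∀ i, p ∣ m i) →
        Φ (toPush (monomial m c)) = monomial (m.mapRange (· / p) (Nat.zero_div p)) (ψ (toPush c)))
    (hno : ∀ (m : σ →₀ ℕ) (c : A), ¬ (∀ i, p ∣ m i) → Φ (toPush (monomial m c)) = 0)
    (F : MvPolynomial σ A) (m' : σ →₀ ℕ) (hm' : m' ∈ (Φ (toPush F)).support) :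
    ∃ m ∈ F.support, (∀ i, p ∣ m i) ∧ m' = m.mapRange (· / p) (Nat.zero_div p) := by
  classical
  have hF : Φ (toPush F) = ∑ m ∈ F.support, Φ (toPush (monomial m (coeff m F))) := by
    conv_lhs => rw [F.as_sum]
    rw [map_sum, map_sum]
  rw [hF] at hm'
  obtain ⟨m, hm, hmm⟩ := Finset.mem_biUnion.mp (MvPolynomial.support_sum hm')
  by_cases hdiv : ∀ i, p ∣ m i
  · rw [hyes m _ hdiv] at hmm
    exact ⟨m, hm, hdiv, Finset.mem_singleton.mp (support_monomial_subset hmm)⟩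
  · rw [hno m _ hdiv] at hmm
    simp at hmm

/-! ## §3 Descent to the presented cone ring `Ring k P D` -/

section Toric

variable (k : Type) [Field k] (P : Type) {d r : ℕ} (D : ConeDatum d r)

/-- **Image of `θ`**: a polynomial all of whose monomials have a word exponent on the distinguished variables is `θ` of an
element of `Ring k P D`. [OURS · L1 W4.5a] -/
theorem exists_eq_theta_of_forall_word (F : MvPolynomial (Fin d ⊕ P) k)
    (hF : ∀ m ∈ F.support, ∃ w : Word d r, wordExp D w = dist m) :
    ∃ z : Ring k P D, theta z = F := by
  classical
  -- one monomial with word exponent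
  have hmono : ∀ (m : (Fin d ⊕ P) →₀ ℕ) (c : k), (∃ w : Word d r, wordExp D w = dist m) →
      ∃ z : Ring k P D, theta z = monomial m c := by
    rintro m c ⟨w, hw⟩
    refine ⟨Ideal.Quotient.mk _ (MvPolynomial.C c * pmonY (k := k) (r := r) (m - ιexp P (dist m))) * wordElem k P D w, ?_⟩
    rw [map_mul, theta_mk, map_mul, presentation_pmonY (m - ιexp P (dist m)) (sub_ιexp_dist_inl m), theta_wordElem,
      xmon_eq_monomial, hw, MvPolynomial.algHom_C, MvPolynomial.algebraMap_eq, mul_assoc, monomial_mul, mul_one,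
      add_comm, ιexp_dist_add_sub, C_mul_monomial, mul_one]
  -- sum over the support
  have hsum : ∀ (s : Finset ((Fin d ⊕ P) →₀ ℕ)), (∀ m ∈ s, ∃ w : Word d r, wordExp D w = dist m) →
      ∃ z : Ring k P D, theta z = ∑ m ∈ s, monomial m (coeff m F) := by
    intro s
    induction s using Finset.induction_on with
    | empty => intro _; exact ⟨0, by rw [map_zero, Finset.sum_empty]⟩
    | insert a s ha ih =>
      intro hs
      obtain ⟨z₁, hz₁⟩ := hmono a (coeff a F) (hs a (Finset.mem_insert_self a s))
      obtain ⟨z₂, hz₂⟩ := ih fun m hm => hs m (Finset.mem_insert_of_mem hm)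
      exact ⟨z₁ + z₂, by rw [map_add, hz₁, hz₂, Finset.sum_insert ha]⟩
  obtain ⟨z, hz⟩ := hsum F.support hF
  exact ⟨z, by rw [hz, ← F.as_sum]⟩

/-- ★ **Saturated cone rings are F-split.** If the word-exponent set of the cone datum `D` is `p`-saturated inside `ℕ^d`
((SAT′): `p ∣ wordExp D w` coordinatewise ⇒ `wordExp D w = p • wordExp D w′` for some word `w′`), then for every field `k` of
characteristic `p` and every passenger type `P` there is a `Ring k P D`-linear `φ : F_* (Ring k P D) → Ring k P D` with `φ(1) = 1` —
the restriction of the ambient splitting of `k[x, passengers]` along `θ`. [OURS · L1 W4.5a; cite: HochsterRoberts1976 (context)] -/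
theorem exists_split_toricRing (p : ℕ) [Fact p.Prime] [CharP k p] [CharP (Ring k P D) p]
    (hsat : ∀ w : Word d r, (∀ s, p ∣ wordExp D w s) → ∃ w' : Word d r, ∀ s, wordExp D w s = p * wordExp D w' s) :
    ∃ φ : FrobeniusPushforward p 1 (Ring k P D) →ₗ[Ring k P D] Ring k P D, φ (toPush 1) = 1 := by
  classical
  have hp0 : 0 < p := (Fact.out : p.Prime).pos
  obtain ⟨ψ, hψ⟩ := exists_split_field p k
  obtain ⟨Φ, hΦ1, hΦyes, hΦno⟩ := exists_split_mvPolynomial p (Fin d ⊕ P) ψ hψ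
  -- `Φ` preserves the image of `θ`
  have himage : ∀ y : Ring k P D, ∃ z : Ring k P D, theta z = Φ (toPush (theta y)) := by
    intro y
    refine exists_eq_theta_of_forall_word k P D _ fun m' hm' => ?_
    obtain ⟨m, hm, hdiv, rfl⟩ := support_split_subset p ψ Φ hΦyes hΦno (theta y) m' hm'
    obtain ⟨w, hw⟩ := exists_word_of_mem_support y m hm
    have hdivw : ∀ s, p ∣ wordExp D w s := fun s => by rw [hw]; exact hdiv (Sum.inl s)
    obtain ⟨w', hw'⟩ := hsat w hdivw
    refine ⟨w', funext fun s => ?_⟩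
    show wordExp D w' s = m (Sum.inl s) / p
    have h1 : m (Sum.inl s) = wordExp D w s := (congrFun hw s).symm
    rw [h1, hw' s, Nat.mul_div_cancel_left _ hp0]
  choose φ₀ hφ₀ using himage
  have hadd : ∀ y y' : Ring k P D, φ₀ (y + y') = φ₀ y + φ₀ y' := fun y y' =>
    theta_injective (by rw [map_add, hφ₀, hφ₀, hφ₀, map_add, map_add, map_add])
  have hmul : ∀ y s : Ring k P D, φ₀ (y ^ p * s) = y * φ₀ s := by
    intro y s
    apply theta_injective
    have h := Φ.map_smul (theta y) (toPush (theta s))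
    rw [smul_toPush, pow_one, smul_eq_mul] at h
    rw [map_mul, hφ₀, hφ₀, map_mul, map_pow, h]
  have hone : φ₀ 1 = 1 := theta_injective (by rw [hφ₀, map_one, hΦ1])
  refine ⟨{ toFun := fun x => φ₀ ((toPush (p := p) (e := 1) (R := Ring k P D)).symm x)
            map_add' := fun x y => by rw [map_add, hadd]
            map_smul' := fun y x => ?_ }, ?_⟩
  · obtain ⟨s, rfl⟩ := (toPush (p := p) (e := 1) (R := Ring k P D)).surjective x
    rw [smul_toPush, RingEquiv.symm_apply_apply, RingEquiv.symm_apply_apply, pow_one, RingHom.id_apply, smul_eq_mul]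
    exact hmul y s
  · show φ₀ ((toPush (p := p) (e := 1) (R := Ring k P D)).symm (toPush 1)) = 1
    rw [RingEquiv.symm_apply_apply]
    exact hone

end Toric

/-! ## §4 Consequence: the Frobenius-closure clause at every localisation

The three localisation lemmas below are ADAPTED VERBATIM from the tree's
`Literature/RingTheory/TightClosure/FrobeniusPushforwardLocalization.lean` (`isLocalizedModule_pushAlgebraMap`,
`exists_linearMap_localization`, `isFrobeniusClosed_localization_of_split`), whose compiled module was not available on the farm
when this file was written; nothing new is claimed for them. -/

/-- `F^e_* (M⁻¹R)` is the localisation of `F^e_* R` at `M` along `pushAlgebraMap`. [cite: HochsterHuneke1989, §3; folklore —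
adapted from tree `FrobeniusPushforward.isLocalizedModule_pushAlgebraMap`] -/
theorem isLocalizedModule_pushAlgebraMap' {p e : ℕ} {R : Type} [CommRing R] [ExpChar R p] (M : Submonoid R) (S : Type) [CommRing S]
    [Algebra R S] [IsLocalization M S] [ExpChar S p] :
    IsLocalizedModule M
      (pushAlgebraMap (p := p) (e := e) S : FrobeniusPushforward p e R →ₗ[R] FrobeniusPushforward p e S) := by
  have hq : p ^ e ≠ 0 := pow_ne_zero e (expChar_ne_zero R p)
  refine ⟨fun s => ?_, fun y => ?_, fun {x₁ x₂} h => ?_⟩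
  · obtain ⟨u, hu⟩ := IsLocalization.map_units S s
    have hsmul : ∀ x : FrobeniusPushforward p e S,
        (algebraMap R (Module.End R (FrobeniusPushforward p e S)) s) x = toPush ((u : S) ^ p ^ e) * x := fun x => by
      rw [Module.algebraMap_end_apply, smul_def, hu]
    refine (Module.End.isUnit_iff _).mpr ⟨fun x y hxy => ?_, fun y => ?_⟩
    · rw [hsmul, hsmul] at hxy
      exact (IsUnit.mul_right_inj ((u.isUnit.pow _).map toPush)).mp hxy
    · refine ⟨toPush (((u⁻¹ : Sˣ) : S) ^ p ^ e) * y, ?_⟩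
      rw [hsmul, ← mul_assoc, ← map_mul, ← mul_pow, Units.mul_inv, one_pow, map_one, one_mul]
  · obtain ⟨y, rfl⟩ := (toPush (p := p) (e := e) (R := S)).surjective y
    obtain ⟨⟨a, s⟩, has⟩ := IsLocalization.surj M y
    have has' : y * algebraMap R S s = algebraMap R S a := has
    refine ⟨⟨toPush (a * (s : R) ^ (p ^ e - 1)), s⟩, ?_⟩
    show s • (toPush y : FrobeniusPushforward p e S) = pushAlgebraMap S (toPush (a * (s : R) ^ (p ^ e - 1)))
    rw [Submonoid.smul_def, pushAlgebraMap_toPush, smul_def, ← map_mul]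
    congr 1
    rw [map_mul, map_pow, ← has', mul_assoc, ← pow_succ', Nat.sub_add_cancel (Nat.one_le_iff_ne_zero.mpr hq), mul_comm]
  · obtain ⟨a, rfl⟩ := (toPush (p := p) (e := e) (R := R)).surjective x₁
    obtain ⟨b, rfl⟩ := (toPush (p := p) (e := e) (R := R)).surjective x₂
    rw [pushAlgebraMap_toPush, pushAlgebraMap_toPush] at h
    have h' : algebraMap R S a = algebraMap R S b := (toPush (p := p) (e := e) (R := S)).injective h
    obtain ⟨c, hc⟩ := IsLocalization.exists_of_eq (M := M) h'
    refine ⟨c, ?_⟩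
    show c • (toPush a : FrobeniusPushforward p e R) = c • (toPush b : FrobeniusPushforward p e R)
    rw [Submonoid.smul_def, Submonoid.smul_def, smul_toPush, smul_toPush, ← Nat.sub_add_cancel (Nat.one_le_iff_ne_zero.mpr hq),
      pow_succ, mul_assoc, hc, ← mul_assoc]

/-- `p^{-e}`-linear maps localise: `φ : F^e_* R → R` induces `φ' : F^e_* S → S` with `φ'(a/1) = φ(a)/1`. [cite: HochsterHuneke1989,
§3; folklore — adapted from tree `FrobeniusPushforward.exists_linearMap_localization`] -/
theorem exists_linearMap_localization' {p e : ℕ} {R : Type} [CommRing R] [ExpChar R p] (M : Submonoid R) (S : Type) [CommRing S]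
    [Algebra R S] [IsLocalization M S] [ExpChar S p] (φ : FrobeniusPushforward p e R →ₗ[R] R) :
    ∃ φ' : FrobeniusPushforward p e S →ₗ[S] S, ∀ r : R, φ' (toPush (algebraMap R S r)) = algebraMap R S (φ (toPush r)) := by
  haveI := isLocalizedModule_pushAlgebraMap' (p := p) (e := e) M S
  let g : FrobeniusPushforward p e R →ₗ[R] S := Algebra.linearMap R S ∘ₗ φ
  have hunits : ∀ s : M, IsUnit (algebraMap R (Module.End R S) s) :=
    IsLocalizedModule.map_units (S := M) (f := Algebra.linearMap R S)
  let ψ : FrobeniusPushforward p e S →ₗ[R] S := IsLocalizedModule.lift M (pushAlgebraMap (p := p) (e := e) S) g hunits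
  refine ⟨ψ.extendScalarsOfIsLocalization M S, fun r => ?_⟩
  show ψ (toPush (algebraMap R S r)) = _
  rw [← pushAlgebraMap_toPush, IsLocalizedModule.lift_apply]
  rfl

/-- **In any localisation of an F-split ring, every ideal satisfies the crux's inline Frobenius-closure clause.**
[folklore; cite: Fedder1983, §1 (F-purity is local) — tree `isFrobeniusClosed_of_split`, `isFrobeniusClosed_iff`] -/
theorem fClause_of_split (p : ℕ) {R S : Type} [CommRing R] [CommRing S] [Algebra R S] (M : Submonoid R) [IsLocalization M S]
    [ExpChar R p] [ExpChar S p] (φ : FrobeniusPushforward p 1 R →ₗ[R] R) (hφ : φ (toPush 1) = 1) (I : Ideal S) :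
    ∀ y : S, (∃ e : ℕ, y ^ p ^ e ∈ Ideal.span ((fun z : S => z ^ p ^ e) '' (I : Set S))) → y ∈ I := by
  obtain ⟨φ', h⟩ := exists_linearMap_localization' (p := p) (e := 1) M S φ
  have h1 : φ' (toPush 1) = 1 := by
    have h1 := h 1
    rw [map_one (algebraMap R S), hφ, map_one (algebraMap R S)] at h1
    exact h1
  exact (isFrobeniusClosed_iff p).mp (isFrobeniusClosed_of_split Nat.one_pos φ' h1 I)

/-- ★ **Every ideal of every localisation of a (SAT′) cone ring is Frobenius closed** (inline clause), every field `k` of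
characteristic `p`. In particular the F-half of the crux's stalk clause `FullCl` holds at every point of `Spec (Ring k P D)`, for
every parameter ideal and indeed for every ideal. [OURS · L1 W4.5a] -/
theorem fClause_localization_toricRing (p : ℕ) [Fact p.Prime] (k : Type) [Field k] [CharP k p] (P : Type) {d r : ℕ}
    (D : ConeDatum d r)
    (hsat : ∀ w : Word d r, (∀ s, p ∣ wordExp D w s) → ∃ w' : Word d r, ∀ s, wordExp D w s = p * wordExp D w' s)
    (S : Type) [CommRing S] [Algebra (Ring k P D) S] (M : Submonoid (Ring k P D)) [IsLocalization M S] (I : Ideal S) :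
    ∀ y : S, (∃ e : ℕ, y ^ p ^ e ∈ Ideal.span ((fun z : S => z ^ p ^ e) '' (I : Set S))) → y ∈ I := by
  haveI := isDomain_ring (k := k) (P := P) (D := D)
  haveI : CharP (Ring k P D) p := charP_of_injective_algebraMap (algebraMap k (Ring k P D)).injective p
  by_cases hS : Nontrivial S
  · haveI : CharP S p := charP_of_algebra_of_prime (R := Ring k P D) p S
    obtain ⟨φ, hφ⟩ := exists_split_toricRing k P D p hsat
    exact fClause_of_split p M φ hφ I
  · intro y _
    haveI : Subsingleton S := not_nontrivial_iff_subsingleton.mp hS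
    rw [Subsingleton.elim y 0]
    exact I.zero_mem

end Summit.ResolutionOfSingularities.ResolutionOfSingularities.Theorems.FInjectiveMacaulayfication.ToricRingSplitting

end
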